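import Mathlib
import HarnessLib
import Summits.RiemannHypothesis.RiemannHypothesis.Theorems.IntegerScrewTailCheck
import Summits.RiemannHypothesis.RiemannHypothesis.Theorems.IntegerScrewTailCell

/-!
# Soundness of the tail checker, I: point enclosures

Membership lemmas for the enclosures of `IntegerScrewTailCheck`: `log 2`, `logPos`, the rational bracket of
`−log(1 − x)` (`Real.abs_log_sub_add_sum_range_le`), `β` (via `RungCert.mem_slopeEncl`), `log(N_c − i)`,
`u_e(N_c)`, `log u`, `Ψ(u)`, `Ψ′(u)`, `Ψ″(u)` (from the landed small-argument expansions) and the per-edge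
point enclosures `edgePoint_sound`.  Nothing here bears on the truth of RH.
-/

set_option autoImplicit false
set_option linter.dupNamespace false

noncomputable section

open scoped Topology
open Real Filter Set

namespace Summit.RiemannHypothesis.RiemannHypothesis.Theorems.IntegerScrew.TopBlockNeg

open Literature.Analysis.ValidatedNumerics Literature.Analysis.ValidatedNumerics.Numerics
open Summit.RiemannHypothesis.RiemannHypothesis.Theorems.IntegerScrew
open Literature.NumberTheory.LFunctions
open Finset


/-- `log 2 ∈ log2FI`. [folklore] -/
theorem mem_log2FI : FI.mem (Real.log 2) log2FI := by
  have hok : FI.logOneSubOK ((FI.ofInt 1).divNat 2) 50 = true := by decide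
  have hy : FI.mem (1 / 2 : ℝ) ((FI.ofInt 1).divNat 2) := by
    simpa using FI.mem_divNat (FI.mem_ofInt 1) (n := 2) (by norm_num)
  have h := FI.mem_logOneSubD hok hy
  have e : Real.log 2 = -Real.log (1 - 1 / 2) := by
    rw [show (1:ℝ) - 1/2 = 2⁻¹ by norm_num, Real.log_inv, neg_neg]
  rw [e]; exact FI.mem_neg h

/-- Soundness of `logPos`. [folklore] -/
theorem mem_logPos {X : FI} {j K : ℕ} {Y : FI} (h : logPos X j K = some Y) {v : ℝ} (hv : FI.mem v X)
    (hv0 : 0 < v) : FI.mem (Real.log v) Y := by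
  unfold logPos at h
  split at h
  · exact absurd h (by simp)
  · rename_i L hL
    simp only [Option.some.injEq] at h
    subst h
    have h2j : (0 : ℝ) < 2 ^ j := by positivity
    have hy : FI.mem (1 - v / 2 ^ j) ((FI.ofInt 1).sub (X.divNat (2 ^ j))) := by
      have := FI.mem_sub (FI.mem_ofInt 1) (FI.mem_divNat hv (n := 2 ^ j) (by positivity))
      simpa using this
    have hlog := FI.mem_logOneSub hL hy
    have e : Real.log v = Real.log 2 * (j : ℤ) + Real.log (1 - (1 - v / 2 ^ j)) := by
      rw [sub_sub_cancel, Real.log_div hv0.ne' h2j.ne', Real.log_pow]; push_cast; ring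
    rw [e]
    exact FI.mem_add (FI.mem_mulInt mem_log2FI _) hlog

/-- The rational bracket of `−log(1 − x)`. [folklore] -/
theorem negLogOneSubQ_spec {x : ℚ} (hx0 : 0 ≤ x) (hx1 : x < 1) (n : ℕ) :
    ((negLogOneSubQ x n).1 : ℝ) ≤ -Real.log (1 - x) ∧ -Real.log (1 - x) ≤ ((negLogOneSubQ x n).2 : ℝ) := by
  have hxa : |(x : ℝ)| < 1 := by rw [abs_of_nonneg (by exact_mod_cast hx0)]; exact_mod_cast hx1
  have h := Real.abs_log_sub_add_sum_range_le hxa n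
  rw [abs_of_nonneg (by exact_mod_cast hx0 : (0:ℝ) ≤ x)] at h
  have hs : ((logSeriesQ x n : ℚ) : ℝ) = ∑ i ∈ Finset.range n, (x : ℝ) ^ (i + 1) / ((i : ℝ) + 1) := by
    rw [logSeriesQ_eq]; push_cast; rfl
  have hr : (((x ^ (n + 1) / (1 - x) : ℚ)) : ℝ) = (x : ℝ) ^ (n + 1) / (1 - x) := by push_cast; rfl
  unfold negLogOneSubQ
  simp only
  push_cast
  rw [abs_le] at h
  constructor <;> linarith [h.1, h.2]

/-- `β ∈ betaFI`. [folklore] -/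
theorem mem_betaFI {B : FI} (h : betaFI = some B) : FI.mem zetaScrewSlope B := by
  unfold betaFI at h
  split at h
  · exact absurd h (by simp)
  · rename_i A hA
    simp only [Option.some.injEq] at h
    subst h
    have hok : FI.logTableOK 16 = true := by decide
    have hlt : ∀ n : ℕ, n ≤ 16 → FI.mem (Real.log (n : ℝ)) (RungCert.lg (FI.logTable 16) n) :=
      fun n hn => by unfold RungCert.lg; exact FI.mem_logTable hok hn
    have hκ := RungCert.mem_slopeEncl hlt (by norm_num) hA
    have h2 := hlt 2 (by norm_num)
    have hpi := FI.mem_divNat FI.mem_pi (n := 4) (by norm_num)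
    have hhalf : FI.mem (1 / 2 : ℝ) ((FI.ofInt 1).divNat 2) := by
      simpa using FI.mem_divNat (FI.mem_ofInt 1) (n := 2) (by norm_num)
    have := FI.mem_sub (FI.mem_add (FI.mem_add h2 hpi) hhalf) (FI.mem_divNat hκ (n := 2) (by norm_num))
    unfold zetaScrewSlope
    convert this using 1
    push_cast; ring

/-- Soundness of `logsAt`: `log(N_c − i) ∈ logsAt logNc N_c i` (`i < N_c`). [folklore] -/
theorem mem_logsAt {logNc : FI} {Nc : ℕ} (hlog : FI.mem (Real.log Nc) logNc) {i : ℕ} (hi : i < Nc) :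
    FI.mem (Real.log ((Nc : ℝ) - i)) (logsAt logNc Nc i) := by
  have hNc : (0 : ℝ) < Nc := by exact_mod_cast (lt_of_le_of_lt (Nat.zero_le i) hi)
  have hiN : (i : ℝ) < Nc := by exact_mod_cast hi
  have hx0 : (0 : ℚ) ≤ (i : ℚ) / Nc := by positivity
  have hx1 : (i : ℚ) / Nc < 1 := by
    rw [div_lt_one (by exact_mod_cast (lt_of_le_of_lt (Nat.zero_le i) hi))]; exact_mod_cast hi
  obtain ⟨h1, h2⟩ := negLogOneSubQ_spec hx0 hx1 8
  have hcast : ((1 : ℝ) - (((i : ℚ) / Nc : ℚ) : ℝ)) = ((Nc : ℝ) - i) / Nc := by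
    push_cast; field_simp
  rw [hcast, Real.log_div (by linarith) hNc.ne'] at h1 h2
  have e : Real.log ((Nc : ℝ) - i) = Real.log Nc - (-(Real.log ((Nc : ℝ) - i) - Real.log Nc)) := by ring
  rw [e]
  unfold logsAt
  exact FI.mem_sub hlog (FI.mem_ofRatRat h1 h2)

/-- `u_e(N) = −log(1 − ℓ/(N − a))`. [folklore] -/
theorem edgeU_eq_negLog {a b : ℕ} {N : ℝ} (hab : a < b) (hN : (b : ℝ) < N) :
    edgeU a b N = -Real.log (1 - ((b : ℝ) - a) / (N - a)) := by
  have hab' : (a : ℝ) < b := by exact_mod_cast hab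
  have ha : (0 : ℝ) < N - a := by linarith
  have hb : (0 : ℝ) < N - b := by linarith
  have e : 1 - ((b : ℝ) - a) / (N - a) = (N - b) / (N - a) := by field_simp; ring
  unfold edgeU
  rw [e, Real.log_div hb.ne' ha.ne']; ring

/-- The rational bracket `uBr` encloses `u_e(N_c)`. [folklore] -/
theorem uBr_spec {a b Nc : ℕ} (hab : a < b) (hN : b < Nc) :
    ((uBr a b Nc).1 : ℝ) ≤ edgeU a b Nc ∧ edgeU a b Nc ≤ ((uBr a b Nc).2 : ℝ) := by
  have haN : a < Nc := lt_trans hab hN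
  have hx0 : (0 : ℚ) ≤ (((b - a : ℕ) : ℚ)) / ((Nc : ℚ) - a) := by
    apply div_nonneg (by positivity)
    have : (a : ℚ) < Nc := by exact_mod_cast haN
    linarith
  have hx1 : (((b - a : ℕ) : ℚ)) / ((Nc : ℚ) - a) < 1 := by
    have : (a : ℚ) < Nc := by exact_mod_cast haN
    rw [div_lt_one (by linarith)]
    push_cast [Nat.cast_sub hab.le]
    have : (b : ℚ) < Nc := by exact_mod_cast hN
    linarith
  obtain ⟨h1, h2⟩ := negLogOneSubQ_spec hx0 hx1 8
  have hcast : (((((b - a : ℕ) : ℚ)) / ((Nc : ℚ) - a) : ℚ) : ℝ) = ((b : ℝ) - a) / ((Nc : ℝ) - a) := by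
    push_cast [Nat.cast_sub hab.le]; ring
  rw [hcast] at h1 h2
  rw [edgeU_eq_negLog hab (by exact_mod_cast hN)]
  exact ⟨h1, h2⟩

/-- `x ≤ u`: `ℓ/(N − a) ≤ u_e(N)`. [folklore] -/
theorem x_le_edgeU {a b : ℕ} {N : ℝ} (hab : a < b) (hN : (b : ℝ) < N) :
    ((b : ℝ) - a) / (N - a) ≤ edgeU a b N := (edgeU_bounds hab hN).1

/-- Soundness of `logUEncl`. [folklore] -/
theorem mem_logUEncl {logNcA logL U LU : FI} {a b Nc : ℕ} (hab : a < b) (hN : b < Nc)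
    (hA : FI.mem (Real.log ((Nc : ℝ) - a)) logNcA) (hL : FI.mem (Real.log ((b : ℝ) - a)) logL)
    {u : ℝ} (hU : FI.mem u U) (hxu : ((b : ℝ) - a) / ((Nc : ℝ) - a) ≤ u)
    (h : logUEncl logNcA logL U a b Nc = some LU) : FI.mem (Real.log u) LU := by
  have hab' : (a : ℝ) < b := by exact_mod_cast hab
  have hbN : (b : ℝ) < Nc := by exact_mod_cast hN
  have hNa : (0 : ℝ) < (Nc : ℝ) - a := by linarith
  have hl0 : (0 : ℝ) < (b : ℝ) - a := by linarith
  set x : ℝ := ((b : ℝ) - a) / ((Nc : ℝ) - a) with hx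
  have hx0 : 0 < x := div_pos hl0 hNa
  have hu0 : 0 < u := lt_of_lt_of_le hx0 hxu
  -- δ = u/x − 1
  set δ : ℝ := u * ((Nc : ℝ) - a) / ((b : ℝ) - a) - 1 with hδ
  have hux : u * ((Nc : ℝ) - a) / ((b : ℝ) - a) = u / x := by
    rw [hx]; field_simp
  have hδ0 : 0 ≤ δ := by
    rw [hδ, hux, sub_nonneg, le_div_iff₀ hx0]; linarith
  unfold logUEncl at h
  dsimp only at h
  split_ifs at h with hhalf
  simp only [Option.some.injEq] at h
  subst h
  -- membership of δ
  have hR : FI.mem (u * ((Nc : ℝ) - a) / ((b : ℝ) - a)) ((U.mulInt ((Nc : ℤ) - a)).divNat (b - a)) := by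
    have h1 := FI.mem_mulInt hU ((Nc : ℤ) - a)
    have h2 := FI.mem_divNat h1 (n := b - a) (by omega)
    convert h2 using 1
    push_cast [Nat.cast_sub hab.le]; ring
  have hD : FI.mem δ (((U.mulInt ((Nc : ℤ) - a)).divNat (b - a)).sub (FI.ofInt 1)) := by
    have := FI.mem_sub hR (FI.mem_ofInt 1)
    convert this using 1; rw [hδ]; push_cast; ring
  have hδhi : δ ≤ (FI.hiQ (((U.mulInt ((Nc : ℤ) - a)).divNat (b - a)).sub (FI.ofInt 1)) : ℝ) :=
    FI.le_hiQ hD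
  push Not at hhalf
  have hhalf' : (FI.hiQ (((U.mulInt ((Nc : ℤ) - a)).divNat (b - a)).sub (FI.ofInt 1)) : ℝ) ≤ 1 / 2 := by
    have : ((FI.hiQ (((U.mulInt ((Nc : ℤ) - a)).divNat (b - a)).sub (FI.ofInt 1)) : ℚ) : ℝ)
        ≤ ((1 / 2 : ℚ) : ℝ) := by exact_mod_cast hhalf
    simpa using this
  have hδ1 : δ ≤ 1 / 2 := le_trans hδhi hhalf'
  -- the 4-term series
  have hd2 := FI.mem_sqr hD
  have hd3 := FI.mem_mul hd2 hD
  have hd4 := FI.mem_sqr hd2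
  have hT : FI.mem (δ - δ ^ 2 / 2 + δ ^ 2 * δ / 3 - (δ ^ 2) ^ 2 / 4)
      (((((((U.mulInt ((Nc : ℤ) - a)).divNat (b - a)).sub (FI.ofInt 1)).sub
        (((((U.mulInt ((Nc : ℤ) - a)).divNat (b - a)).sub (FI.ofInt 1)).sqr).divNat 2)).add
        ((((((U.mulInt ((Nc : ℤ) - a)).divNat (b - a)).sub (FI.ofInt 1)).sqr).mul
          (((U.mulInt ((Nc : ℤ) - a)).divNat (b - a)).sub (FI.ofInt 1))).divNat 3)).sub
        ((((((U.mulInt ((Nc : ℤ) - a)).divNat (b - a)).sub (FI.ofInt 1)).sqr).sqr).divNat 4))) := by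
    have := FI.mem_sub (FI.mem_add (FI.mem_sub hD (FI.mem_divNat hd2 (n := 2) (by norm_num)))
      (FI.mem_divNat hd3 (n := 3) (by norm_num))) (FI.mem_divNat hd4 (n := 4) (by norm_num))
    convert this using 1; push_cast; ring
  -- |log(1+δ) − T(δ)| ≤ 2 δhi⁵
  have habs : |(-δ)| < 1 := by rw [abs_neg, abs_of_nonneg hδ0]; linarith
  have hser := Real.abs_log_sub_add_sum_range_le habs 4
  rw [abs_neg, abs_of_nonneg hδ0, sub_neg_eq_add] at hser
  have hsum : ∑ i ∈ Finset.range 4, (-δ) ^ (i + 1) / ((i : ℝ) + 1)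
      = -(δ - δ ^ 2 / 2 + δ ^ 2 * δ / 3 - (δ ^ 2) ^ 2 / 4) := by
    simp [Finset.sum_range_succ]; ring
  rw [hsum] at hser
  have htail : δ ^ 5 / (1 - δ) ≤ 2 * (FI.hiQ (((U.mulInt ((Nc : ℤ) - a)).divNat (b - a)).sub (FI.ofInt 1)) : ℝ) ^ 5 := by
    have h1 : δ ^ 5 / (1 - δ) ≤ 2 * δ ^ 5 := by
      rw [div_le_iff₀ (by linarith)]; nlinarith [pow_nonneg hδ0 5]
    have h2 : δ ^ 5 ≤ (FI.hiQ (((U.mulInt ((Nc : ℤ) - a)).divNat (b - a)).sub (FI.ofInt 1)) : ℝ) ^ 5 :=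
      pow_le_pow_left₀ hδ0 hδhi 5
    linarith
  have hlog1 : |Real.log (1 + δ) - (δ - δ ^ 2 / 2 + δ ^ 2 * δ / 3 - (δ ^ 2) ^ 2 / 4)|
      ≤ ((2 * (FI.hiQ (((U.mulInt ((Nc : ℤ) - a)).divNat (b - a)).sub (FI.ofInt 1))) ^ 5 : ℚ) : ℝ) := by
    push_cast
    have e : Real.log (1 + δ) - (δ - δ ^ 2 / 2 + δ ^ 2 * δ / 3 - (δ ^ 2) ^ 2 / 4)
        = -(δ - δ ^ 2 / 2 + δ ^ 2 * δ / 3 - (δ ^ 2) ^ 2 / 4) + Real.log (1 + δ) := by ring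
    rw [e]
    rw [show (4 : ℕ) + 1 = 5 from rfl] at hser
    exact hser.trans htail
  have hL1 := FI.mem_widenQ hT hlog1
  -- log u = (log ℓ − log(Nc − a)) + log(1 + δ)
  have hlogu : Real.log u = (Real.log ((b : ℝ) - a) - Real.log ((Nc : ℝ) - a)) + Real.log (1 + δ) := by
    have h1d : 1 + δ = u / x := by rw [hδ, hux]; ring
    rw [h1d, Real.log_div hu0.ne' hx0.ne', hx, Real.log_div hl0.ne' hNa.ne']; ring
  rw [hlogu]
  exact FI.mem_add (FI.mem_sub hL hA) hL1

/-- Soundness of `psiEncl`: `Ψ(u) ∈ psiEncl B U LU` (`0 < u ≤ 1/2`). [folklore] -/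
theorem mem_psiEncl {B U LU : FI} {u : ℝ} (hB : FI.mem zetaScrewSlope B) (hU : FI.mem u U)
    (hLU : FI.mem (Real.log u) LU) (hu0 : 0 < u) (hu1 : u ≤ 1 / 2) :
    FI.mem (zetaScrew u) (psiEncl B U LU) := by
  obtain ⟨hlo, hhi⟩ := zetaScrew_smallArg_bounds hu0 hu1
  have h2 := FI.mem_sqr hU
  have h3 := FI.mem_mul h2 hU
  have h4 := FI.mem_sqr h2
  have h5 := FI.mem_mul h4 hU
  have h6 := FI.mem_sqr h3
  have e3 : u ^ 2 * u = u ^ 3 := by ring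
  have e4 : (u ^ 2) ^ 2 = u ^ 4 := by ring
  have e5 : (u ^ 2) ^ 2 * u = u ^ 5 := by ring
  have e6 : (u ^ 2 * u) ^ 2 = u ^ 6 := by ring
  rw [e3] at h3; rw [e4] at h4; rw [e5] at h5; rw [e6] at h6
  have hmain : FI.mem (zetaScrewMain u)
      ((((U.mul LU).divNat 2).neg.add (B.mul U)).add ((U.sqr.mulInt 7).divNat 8)) := by
    have := FI.mem_add (FI.mem_add (FI.mem_neg (FI.mem_divNat (FI.mem_mul hU hLU) (n := 2) (by norm_num)))
      (FI.mem_mul hB hU)) (FI.mem_divNat (FI.mem_mulInt h2 7) (n := 8) (by norm_num))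
    unfold zetaScrewMain; convert this using 1; push_cast; ring
  have hRL : FI.mem (u ^ 3 / 288 + u ^ 4 / 48 - u ^ 5 / 16000 - u ^ 6 / 4800)
      ((((U.sqr.mul U).divNat 288).add (U.sqr.sqr.divNat 48)).sub ((U.sqr.sqr.mul U).divNat 16000) |>.sub
        ((U.sqr.mul U).sqr.divNat 4800)) := by
    have := FI.mem_sub (FI.mem_sub (FI.mem_add (FI.mem_divNat h3 (n := 288) (by norm_num))
      (FI.mem_divNat h4 (n := 48) (by norm_num))) (FI.mem_divNat h5 (n := 16000) (by norm_num)))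
      (FI.mem_divNat h6 (n := 4800) (by norm_num))
    convert this using 1; push_cast; ring
  have hRU : FI.mem (u ^ 3 / 288 + 3 / 128 * u ^ 4 + u ^ 5 / 64000 + 17 / 72000 * u ^ 6)
      (((((U.sqr.mul U).divNat 288).add ((U.sqr.sqr.mulInt 3).divNat 128)).add
        ((U.sqr.sqr.mul U).divNat 64000)).add (((U.sqr.mul U).sqr.mulInt 17).divNat 72000)) := by
    have := FI.mem_add (FI.mem_add (FI.mem_add (FI.mem_divNat h3 (n := 288) (by norm_num))
      (FI.mem_divNat (FI.mem_mulInt h4 3) (n := 128) (by norm_num)))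
      (FI.mem_divNat h5 (n := 64000) (by norm_num)))
      (FI.mem_divNat (FI.mem_mulInt h6 17) (n := 72000) (by norm_num))
    convert this using 1; push_cast; ring
  have hrem := FI.mem_span hRL hRU hlo hhi
  have := FI.mem_add hmain hrem
  unfold psiEncl
  convert this using 1; ring

/-- Soundness of `psi1Encl`: `Ψ′(u) ∈ psi1Encl B U LU` (`0 < u ≤ 2`). [folklore] -/
theorem mem_psi1Encl {B U LU : FI} {u : ℝ} (hB : FI.mem zetaScrewSlope B) (hU : FI.mem u U)
    (hLU : FI.mem (Real.log u) LU) (hu0 : 0 < u) (hu2 : u ≤ 2) :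
    FI.mem (zetaScrewDeriv u) (psi1Encl B U LU) := by
  obtain ⟨hlo, hhi⟩ := zetaScrewDeriv_bracket hu0 hu2
  have h2 := FI.mem_sqr hU
  have h3 := FI.mem_mul h2 hU
  have h4 := FI.mem_sqr h2
  have h5 := FI.mem_mul h4 hU
  have e3 : u ^ 2 * u = u ^ 3 := by ring
  have e4 : (u ^ 2) ^ 2 = u ^ 4 := by ring
  have e5 : (u ^ 2) ^ 2 * u = u ^ 5 := by ring
  rw [e3] at h3; rw [e4] at h4; rw [e5] at h5
  have hhalf : FI.mem (1 / 2 : ℝ) ((FI.ofInt 1).divNat 2) := by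
    simpa using FI.mem_divNat (FI.mem_ofInt 1) (n := 2) (by norm_num)
  have hmain : FI.mem (-(Real.log u) / 2 + (zetaScrewSlope - 1 / 2) + 7 / 4 * u)
      ((((LU.divNat 2).neg.add (B.sub ((FI.ofInt 1).divNat 2))).add ((U.mulInt 7).divNat 4))) := by
    have := FI.mem_add (FI.mem_add (FI.mem_neg (FI.mem_divNat hLU (n := 2) (by norm_num)))
      (FI.mem_sub hB hhalf)) (FI.mem_divNat (FI.mem_mulInt hU 7) (n := 4) (by norm_num))
    convert this using 1; push_cast; ring
  have hPL : FI.mem (u ^ 2 / 96 + u ^ 3 / 12 - u ^ 4 / 3200 - u ^ 5 / 800)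
      ((((U.sqr.divNat 96).add ((U.sqr.mul U).divNat 12)).sub (U.sqr.sqr.divNat 3200)).sub
        ((U.sqr.sqr.mul U).divNat 800)) := by
    have := FI.mem_sub (FI.mem_sub (FI.mem_add (FI.mem_divNat h2 (n := 96) (by norm_num))
      (FI.mem_divNat h3 (n := 12) (by norm_num))) (FI.mem_divNat h4 (n := 3200) (by norm_num)))
      (FI.mem_divNat h5 (n := 800) (by norm_num))
    convert this using 1; push_cast; ring
  have hPU : FI.mem (u ^ 2 / 96 + 3 / 32 * u ^ 3 + u ^ 4 / 12800 + 17 / 12000 * u ^ 5)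
      ((((U.sqr.divNat 96).add (((U.sqr.mul U).mulInt 3).divNat 32)).add (U.sqr.sqr.divNat 12800)).add
        (((U.sqr.sqr.mul U).mulInt 17).divNat 12000)) := by
    have := FI.mem_add (FI.mem_add (FI.mem_add (FI.mem_divNat h2 (n := 96) (by norm_num))
      (FI.mem_divNat (FI.mem_mulInt h3 3) (n := 32) (by norm_num)))
      (FI.mem_divNat h4 (n := 12800) (by norm_num)))
      (FI.mem_divNat (FI.mem_mulInt h5 17) (n := 12000) (by norm_num))
    convert this using 1; push_cast; ring
  have hx1 : u ^ 2 / 96 + u ^ 3 / 12 - u ^ 4 / 3200 - u ^ 5 / 800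
      ≤ zetaScrewDeriv u - (-(Real.log u) / 2 + (zetaScrewSlope - 1 / 2) + 7 / 4 * u) := by linarith
  have hx2 : zetaScrewDeriv u - (-(Real.log u) / 2 + (zetaScrewSlope - 1 / 2) + 7 / 4 * u)
      ≤ u ^ 2 / 96 + 3 / 32 * u ^ 3 + u ^ 4 / 12800 + 17 / 12000 * u ^ 5 := by linarith
  have hrem := FI.mem_span hPL hPU hx1 hx2
  have := FI.mem_add hmain hrem
  unfold psi1Encl
  convert this using 1; ring

/-- Soundness of `psi2Encl`: `Ψ″(u) ∈ psi2Encl U ub` (`0 < ub.1 ≤ u ≤ ub.2`, `u ≤ 2`). [folklore] -/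
theorem mem_psi2Encl {U : FI} {ub : ℚ × ℚ} {u : ℝ} (hU : FI.mem u U) (hlo : (ub.1 : ℝ) ≤ u)
    (hhi : u ≤ (ub.2 : ℝ)) (hub0 : 0 < ub.1) (hu2 : u ≤ 2) :
    FI.mem (zetaScrewDeriv2 u) (psi2Encl U ub) := by
  have hub0' : (0 : ℝ) < ub.1 := by exact_mod_cast hub0
  have hu0 : 0 < u := lt_of_lt_of_le hub0' hlo
  obtain ⟨blo, bhi⟩ := zetaScrewDeriv2_bracket hu0 hu2
  have h2 := FI.mem_sqr hU
  have h3 := FI.mem_mul h2 hU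
  have h4 := FI.mem_sqr h2
  have e3 : u ^ 2 * u = u ^ 3 := by ring
  have e4 : (u ^ 2) ^ 2 = u ^ 4 := by ring
  rw [e3] at h3; rw [e4] at h4
  have hinv : FI.mem (1 / (2 * u)) (FI.ofRatRat (1 / (2 * ub.2)) (1 / (2 * ub.1))) := by
    refine FI.mem_ofRatRat ?_ ?_
    · push_cast
      exact one_div_le_one_div_of_le (by positivity) (by linarith)
    · push_cast
      exact one_div_le_one_div_of_le (by positivity) (by linarith)
  have h74 : FI.mem (7 / 4 : ℝ) ((FI.ofInt 7).divNat 4) := by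
    simpa using FI.mem_divNat (FI.mem_ofInt 7) (n := 4) (by norm_num)
  have hmain : FI.mem (7 / 4 - 1 / (2 * u)) (((FI.ofInt 7).divNat 4).sub
      (FI.ofRatRat (1 / (2 * ub.2)) (1 / (2 * ub.1)))) := FI.mem_sub h74 hinv
  have hQL : FI.mem (u / 48 - u ^ 3 / 800) ((U.divNat 48).sub ((U.sqr.mul U).divNat 800)) :=
    FI.mem_sub (FI.mem_divNat hU (n := 48) (by norm_num)) (FI.mem_divNat h3 (n := 800) (by norm_num))
  have hQU : FI.mem ((u / 2) ^ 2 + 5 / 48 * (u / 2) ^ 4 + (u / 48 + u ^ 3 / 3200) + (u ^ 2 / 32 + u ^ 4 / 1200))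
      ((((((U.sqr.divNat 4).add ((U.sqr.sqr.mulInt 5).divNat 768)).add (U.divNat 48)).add
        ((U.sqr.mul U).divNat 3200)).add (U.sqr.divNat 32)).add (U.sqr.sqr.divNat 1200)) := by
    have := FI.mem_add (FI.mem_add (FI.mem_add (FI.mem_add (FI.mem_add
      (FI.mem_divNat h2 (n := 4) (by norm_num))
      (FI.mem_divNat (FI.mem_mulInt h4 5) (n := 768) (by norm_num)))
      (FI.mem_divNat hU (n := 48) (by norm_num)))
      (FI.mem_divNat h3 (n := 3200) (by norm_num)))
      (FI.mem_divNat h2 (n := 32) (by norm_num)))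
      (FI.mem_divNat h4 (n := 1200) (by norm_num))
    convert this using 1; push_cast; ring
  have hx1 : u / 48 - u ^ 3 / 800 ≤ zetaScrewDeriv2 u - (7 / 4 - 1 / (2 * u)) := by linarith
  have hx2 : zetaScrewDeriv2 u - (7 / 4 - 1 / (2 * u))
      ≤ (u / 2) ^ 2 + 5 / 48 * (u / 2) ^ 4 + (u / 48 + u ^ 3 / 3200) + (u ^ 2 / 32 + u ^ 4 / 1200) := by linarith
  have hrem := FI.mem_span hQL hQU hx1 hx2
  have := FI.mem_add hmain hrem
  unfold psi2Encl
  convert this using 1; ring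


end Summit.RiemannHypothesis.RiemannHypothesis.Theorems.IntegerScrew.TopBlockNeg

end
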